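import Mathlib.Analysis.Fourier.AddCircleMulti
import Mathlib.Analysis.SpecialFunctions.Complex.Log
import HarnessLib

/-!
# Character sums over the `n`-torsion grid of the torus `T^d` (orthogonality of additive characters)

FunctionSpaces proof-support file (everything proved; no definitions, no named facts).  For `n ≥ 1` the points
`x_j = (j_1/n, …, j_d/n)`, `j ∈ {0, …, n−1}^d`, form the `n`-torsion subgroup `(n⁻¹ℤ/ℤ)^d` of `T^d = (ℝ/ℤ)^d`, and the
Fourier characters `e_k(x) = ∏ᵢ exp(2πi kᵢ xᵢ)` restricted to it are the additive characters of `(ℤ/nℤ)^d`.  Their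
orthogonality (Montgomery–Vaughan, eq. (4.1): `(1/q) Σ_{k=1}^{q} e(−ka/q) e(kn/q) = [n ≡ a (mod q)]`) reads:

* `sum_exp_two_pi_mul_div` — one variable: `Σ_{j<n} exp(2πi m j/n) = n` if `n ∣ m`, `= 0` otherwise;
* `sum_mFourier_grid` — `Σ_{j ∈ (ℤ/n)^d} e_k(x_j) = n^d` if `n ∣ kᵢ` for every `i`, `= 0` otherwise;
* `sum_cos_mul_mFourier_grid` — with the real weights `cos(2π ℓ·j/n)`:
  `Σ_j cos(2π ℓ·j/n) e_k(x_j) = ½ (Σ_j e_{k+ℓ}(x_j) + Σ_j e_{k−ℓ}(x_j))`, i.e. `½ n^d ([k ≡ −ℓ] + [k ≡ ℓ])` (mod `n`,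
  componentwise) — the multiplier of the real Bloch-sector projection `n^{-d} Σ_j 2cos(2π ℓ·j/n) τ_{x_j}` onto the
  symmetric sector `{k ≡ ±ℓ (mod n)}`.

Consumer: the Bloch-sector preservation of weak passive-vector solutions along `1/n`-periodic carriers
(`FluidPDE/PassiveVectorTensorSymmetry`, K1L tensor cell stubs of route `SolenoidalFractalHomogenisation`, cell `ad-ideate`).

## Mathlib / tree search

Mathlib: `UnitAddTorus.mFourier` (`∏ᵢ fourier (kᵢ) (xᵢ)`), `fourier_coe_apply`, `Complex.exp_eq_one_iff`,
`Complex.exp_int_mul_two_pi_mul_I`, `Complex.exp_nat_mul`, `geom_sum_eq`, `Finset.prod_univ_sum`, `Complex.two_cos`,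
`Complex.ofReal_cos`.  Tree: `TorusDirichletKernelProofs` (one-variable geometric sums of `exp(2πi·)`, Grafakos (3.1.15)).
No grid / torsion-subgroup character sum existed (2026-08-28).

## References

* H. L. Montgomery, R. C. Vaughan, *Multiplicative Number Theory I. Classical Theory*, CUP 2007, §4.1 eq. (4.1). [`MontgomeryVaughan2007`]
* L. Grafakos, *Classical Fourier Analysis*, 3rd ed. (2014), §3.1.1 (the characters of `T^n`). [`Grafakos2014`]
-/

noncomputable section

open Complex Finset
open scoped Real BigOperators

namespace Literature.Analysis.FunctionSpaces.Torus

/-! ## One variable -/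

/-- `exp(2πi m j / n) = exp(2πi m / n)^j`. [cite: MontgomeryVaughan2007, §4.1 eq. (4.1)] -/
theorem exp_two_pi_mul_div_nat (n : ℕ) (m : ℤ) (j : ℕ) :
    Complex.exp (2 * π * I * m * j / n) = Complex.exp (2 * π * I * m / n) ^ j := by
  rw [← Complex.exp_nat_mul]
  congr 1
  ring

/-- `exp(2πi m / n) = 1` iff `n ∣ m` (`n ≥ 1`). [cite: MontgomeryVaughan2007, §4.1 eq. (4.1)] -/
theorem exp_two_pi_mul_div_eq_one_iff {n : ℕ} (hn : 0 < n) (m : ℤ) :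
    Complex.exp (2 * π * I * m / n) = 1 ↔ (n : ℤ) ∣ m := by
  have hn' : (n : ℂ) ≠ 0 := by exact_mod_cast hn.ne'
  have h2π : (2 * π * I : ℂ) ≠ 0 := by
    have : (π : ℂ) ≠ 0 := by exact_mod_cast Real.pi_ne_zero
    simp [this, I_ne_zero]
  constructor
  · intro h
    obtain ⟨q, hq⟩ := Complex.exp_eq_one_iff.1 h
    refine ⟨q, ?_⟩
    have h1 : (m : ℂ) = n * q := by
      have := congrArg (fun z => z * n / (2 * π * I)) hq
      field_simp at this
      linear_combination this
    exact_mod_cast h1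
  · rintro ⟨q, rfl⟩
    have e : (2 * π * I * ((n * q : ℤ) : ℂ) / n) = q * (2 * π * I) := by
      push_cast
      field_simp
    rw [e]
    exact Complex.exp_int_mul_two_pi_mul_I q

/-- **Orthogonality of the additive characters of `ℤ/nℤ`**: `Σ_{j<n} exp(2πi m j/n) = n` if `n ∣ m`, else `0`.
[cite: MontgomeryVaughan2007, §4.1 eq. (4.1)] -/
theorem sum_exp_two_pi_mul_div {n : ℕ} (hn : 0 < n) (m : ℤ) :
    ∑ j : Fin n, Complex.exp (2 * π * I * m * (j : ℕ) / n) = if (n : ℤ) ∣ m then (n : ℂ) else 0 := by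
  simp_rw [exp_two_pi_mul_div_nat]
  rw [Fin.sum_univ_eq_sum_range (fun j => Complex.exp (2 * π * I * m / n) ^ j) n]
  split_ifs with h
  · rw [(exp_two_pi_mul_div_eq_one_iff hn m).2 h]
    simp
  · have hne : Complex.exp (2 * π * I * m / n) ≠ 1 := fun h1 => h ((exp_two_pi_mul_div_eq_one_iff hn m).1 h1)
    rw [geom_sum_eq hne]
    have hpow : Complex.exp (2 * π * I * m / n) ^ n = 1 := by
      rw [← Complex.exp_nat_mul]
      have hn' : (n : ℂ) ≠ 0 := by exact_mod_cast hn.ne'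
      have e : (n : ℂ) * (2 * π * I * m / n) = m * (2 * π * I) := by
        field_simp
      rw [e]
      exact Complex.exp_int_mul_two_pi_mul_I m
    rw [hpow, sub_self, zero_div]

/-! ## The grid of `T^d` -/

variable {d : Type*} [Fintype d] [DecidableEq d]

omit [DecidableEq d] in
/-- The character `e_k` at the grid point `x_j = (jᵢ/n)ᵢ`: `e_k(x_j) = ∏ᵢ exp(2πi kᵢ jᵢ / n)`.
[cite: Grafakos2014, §3.1.1 (the characters of the torus)] -/
theorem mFourier_grid (n : ℕ) (k : d → ℤ) (j : d → Fin n) :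
    UnitAddTorus.mFourier k (fun i => ((((j i : ℕ) : ℝ) / n : ℝ) : UnitAddCircle)) =
      ∏ i, Complex.exp (2 * π * I * (k i) * ((j i : ℕ) : ℂ) / n) := by
  simp only [UnitAddTorus.mFourier, ContinuousMap.coe_mk]
  refine Finset.prod_congr rfl fun i _ => ?_
  rw [fourier_coe_apply]
  push_cast
  ring_nf

/-- **Orthogonality over the grid**: `Σ_{j ∈ (ℤ/n)^d} e_k(x_j) = n^d` if `n ∣ kᵢ` for all `i`, else `0` (`n ≥ 1`).
[cite: MontgomeryVaughan2007, §4.1 eq. (4.1)] -/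
theorem sum_mFourier_grid {n : ℕ} (hn : 0 < n) (k : d → ℤ) :
    ∑ j : d → Fin n, UnitAddTorus.mFourier k (fun i => ((((j i : ℕ) : ℝ) / n : ℝ) : UnitAddCircle)) =
      if ∀ i, (n : ℤ) ∣ k i then ((n : ℂ) ^ Fintype.card d) else 0 := by
  classical
  simp_rw [mFourier_grid]
  have key : ∑ j : d → Fin n, ∏ i, Complex.exp (2 * π * I * (k i) * ((j i : ℕ) : ℂ) / n) =
      ∏ i : d, ∑ j : Fin n, Complex.exp (2 * π * I * (k i) * ((j : ℕ) : ℂ) / n) := by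
    rw [Finset.prod_univ_sum]
    simp only [Fintype.piFinset_univ]
  rw [key]
  simp_rw [sum_exp_two_pi_mul_div hn]
  split_ifs with h
  · rw [Finset.prod_congr rfl fun i _ => if_pos (h i), Finset.prod_const, Finset.card_univ]
  · push Not at h
    obtain ⟨i, hi⟩ := h
    exact Finset.prod_eq_zero (Finset.mem_univ i) (if_neg hi)

omit [DecidableEq d] in
/-- The cosine weight as half a sum of two characters at a grid point:
`cos(2π ℓ·j/n) = ½ (e_ℓ(x_j) + e_{−ℓ}(x_j))`. [cite: MontgomeryVaughan2007, §4.1 eq. (4.1)] -/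
theorem cos_grid_eq (n : ℕ) (ℓ : d → ℤ) (j : d → Fin n) :
    ((Real.cos (2 * π * (∑ i, (ℓ i : ℝ) * ((j i : ℕ) : ℝ)) / n) : ℝ) : ℂ) =
      (UnitAddTorus.mFourier ℓ (fun i => ((((j i : ℕ) : ℝ) / n : ℝ) : UnitAddCircle)) +
        UnitAddTorus.mFourier (-ℓ) (fun i => ((((j i : ℕ) : ℝ) / n : ℝ) : UnitAddCircle))) / 2 := by
  rw [mFourier_grid, mFourier_grid, Complex.ofReal_cos]
  have e1 : ∏ i, Complex.exp (2 * π * I * (ℓ i) * ((j i : ℕ) : ℂ) / n) =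
      Complex.exp ((2 * π * (∑ i, (ℓ i : ℝ) * ((j i : ℕ) : ℝ)) / n : ℝ) * I) := by
    rw [← Complex.exp_sum]
    congr 1
    push_cast
    simp only [Finset.mul_sum, Finset.sum_div, Finset.sum_mul]
    refine Finset.sum_congr rfl fun i _ => ?_
    ring
  have e2 : ∏ i, Complex.exp (2 * π * I * ((-ℓ) i) * ((j i : ℕ) : ℂ) / n) =
      Complex.exp (-((2 * π * (∑ i, (ℓ i : ℝ) * ((j i : ℕ) : ℝ)) / n : ℝ)) * I) := by
    rw [← Complex.exp_sum]
    congr 1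
    push_cast
    simp only [Finset.mul_sum, Finset.sum_div, Finset.sum_mul, ← Finset.sum_neg_distrib, Pi.neg_apply, Int.cast_neg]
    refine Finset.sum_congr rfl fun i _ => ?_
    ring
  rw [e1, e2, ← Complex.two_cos]
  ring

/-- **Multiplier of the real Bloch-sector average.**  With the weights `cos(2π ℓ·j/n)` on the grid,
`Σ_j cos(2π ℓ·j/n) e_k(x_j) = ½ (S(k+ℓ) + S(k−ℓ))`, `S(k') = n^d [n ∣ k'ᵢ ∀ i]`: it equals `0` off the symmetric
sector `{k ≡ ±ℓ (mod n)}`. [cite: MontgomeryVaughan2007, §4.1 eq. (4.1)] -/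
theorem sum_cos_mul_mFourier_grid {n : ℕ} (hn : 0 < n) (ℓ k : d → ℤ) :
    ∑ j : d → Fin n, ((Real.cos (2 * π * (∑ i, (ℓ i : ℝ) * ((j i : ℕ) : ℝ)) / n) : ℝ) : ℂ) *
        UnitAddTorus.mFourier k (fun i => ((((j i : ℕ) : ℝ) / n : ℝ) : UnitAddCircle)) =
      ((if ∀ i, (n : ℤ) ∣ k i + ℓ i then ((n : ℂ) ^ Fintype.card d) else 0) +
        (if ∀ i, (n : ℤ) ∣ k i - ℓ i then ((n : ℂ) ^ Fintype.card d) else 0)) / 2 := by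
  have hadd : ∀ j : d → Fin n,
      ((Real.cos (2 * π * (∑ i, (ℓ i : ℝ) * ((j i : ℕ) : ℝ)) / n) : ℝ) : ℂ) *
        UnitAddTorus.mFourier k (fun i => ((((j i : ℕ) : ℝ) / n : ℝ) : UnitAddCircle)) =
      (UnitAddTorus.mFourier (k + ℓ) (fun i => ((((j i : ℕ) : ℝ) / n : ℝ) : UnitAddCircle)) +
        UnitAddTorus.mFourier (k - ℓ) (fun i => ((((j i : ℕ) : ℝ) / n : ℝ) : UnitAddCircle))) / 2 := by
    intro j
    rw [cos_grid_eq, sub_eq_add_neg, UnitAddTorus.mFourier_add, UnitAddTorus.mFourier_add]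
    ring
  simp_rw [hadd]
  rw [← Finset.sum_div, Finset.sum_add_distrib, sum_mFourier_grid hn, sum_mFourier_grid hn]
  simp only [Pi.add_apply, Pi.sub_apply]

end Literature.Analysis.FunctionSpaces.Torus

end
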